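import Summits.Schanuel.Schanuel.Theorems.DiophantineDichotomyKhovanskiiApproxTypeEvLambertExpRational

/-!
# Line `lambert-liouville-kill` — crux `DiophantineDichotomy.KhovanskiiApproxTypeEv` (stmt-Schanuel-14972)
# EXTENSION SKELETON v2 (lead `prover-line-stmt-Schanuel-14972-a1-0`): the general exp-rational certificate is
# LANDED — this file is now import-only

v1 (this lead, commit 0f02ab689578): composition `notLiouville_expRational_of_ev` sorry-free modulo five new registered
stubs.  v2: all six extension stubs and the composition are LANDED under `Theorems/` (`--supports stmt-Schanuel-14972`,
axioms standard, no named fact):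
`stub_expRationalPoint` p128852 · `stub_liouvilleWindowInt` p128799 · `stub_expRationalSlotHeight` p128890 ·
`stub_expRationalLevel` p128889 · `stub_expRationalLipschitz` p128935 · `stub_expRationalDist` p128865 ·
`notLiouville_expRational_of_ev` (+ `notLiouville_lambertW_of_ev`) in
`Theorems/DiophantineDichotomyKhovanskiiApproxTypeEvLambertExpRational.lean`.

Certified: `KhovanskiiApproxTypeEv → ∀ (A B : ℤ[X]) (x : ℝ), A(x)·eˣ = B(x) → eˣ(A(x)+A′(x)) ≠ B′(x) → ¬ Liouville x`
— the crux forbids every real simple zero of an exponential polynomial `A(t)eᵗ − B(t)` over `ℤ` (all `W(r)`,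
`r ∈ ℚ_{>0}`, the omega constant, …) to be Liouville: the planners' kill criterion Z′ in its natural generality for
Lambert-tied slots of `y`-degree one.
-/

noncomputable section

set_option linter.dupNamespace false

namespace Summit.Schanuel.Schanuel.Cruxes.KhovanskiiApproxTypeEv.LambertLiouvilleKill

open Summit.Schanuel.Schanuel.Theses.DiophantineDichotomy (KhovanskiiApproxTypeEv)
open Polynomial

/-- Re-export check: the landed general certificate has exactly the registered type. -/
example : KhovanskiiApproxTypeEv → ∀ (A B : ℤ[X]) (x : ℝ),
    Polynomial.aeval x A * Real.exp x = Polynomial.aeval x B →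
    Real.exp x * (Polynomial.aeval x A + Polynomial.aeval x (Polynomial.derivative A)) ≠
      Polynomial.aeval x (Polynomial.derivative B) →
    ¬ Liouville x :=
  notLiouville_expRational_of_ev

/-- Re-export check: the Lambert `W(v/u)` corollary. -/
example (hEv : KhovanskiiApproxTypeEv) (u v : ℕ) (x : ℝ) (hu : 1 ≤ u) (hv : 1 ≤ v)
    (hx : (u : ℝ) * x * Real.exp x = v) : ¬ Liouville x :=
  notLiouville_lambertW_of_ev hEv u v x hu hv hx

end Summit.Schanuel.Schanuel.Cruxes.KhovanskiiApproxTypeEv.LambertLiouvilleKill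

end
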